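import Literature.AlgebraicGeometry.Frobenioids.PerfectionEquivalence
import Literature.AlgebraicGeometry.Frobenioids.PerfectionLifting
import Literature.AlgebraicGeometry.Frobenioids.PerfectionPreSteps
import Literature.AlgebraicGeometry.Frobenioids.PerfectionProofs
import Literature.AlgebraicGeometry.Frobenioids.RigiditySlimness
import Literature.AlgebraicGeometry.Frobenioids.EquivalenceUnitsTransport
import HarnessLib

/-!
# Frobenioids I, Theorem 3.4 (iii) — the rigidity clause of the perfection square: `C → C^pf` is
# rigid for `D` slim and `C` of Frobenius-normalized type

Mochizuki, *The geometry of Frobenioids I: the general theory*, Kyushu J. Math. **62** (2008)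
293–400, Thm. 3.4 (iii), kurims text p. 62 ("Finally, if `D₁, D₂` are slim, then each of the composite
functors of this diagram is rigid", the diagram being the `C → C^pf` square) and its proof p. 64
ll. 28–32: "to verify the asserted rigidity of composite functors, it suffices [cf. the argument applied
in the proof of assertion (i)] to apply Proposition 1.13, (ii), and to consider the functoriality of the
automorphisms in question with respect to base-identity endomorphisms of Frobenius-trivial objects of
arbitrary Frobenius degree" [cite: MochizukiFrdI2008, Thm. 3.4 (iii) p.62].

PROOF-ONLY file (seat abc-iut-w4-d090; sub-DAG `plan/L1/SUBDAG-FrdI-Thm34.md` row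
`FrdI:Thm3.4(iii)/L02 RigidityOfPfComposites`; no new notions) over THE perfection `C → C^pf` of seat
abc-iut-L1-d9 (`Perfection*.lean`: `Perfection.toPf hF`, operations `Perfection.ops hF`, the datum
`PreFrobenioidData.perfection hF`), following the template of `BirationalizationRigidity.lean`
(abc-iut-L1-t10, the `C → C^birat` twin of Cor. 4.10):

* `Perfection.toPf_map_eq_mk_conj`, `Perfection.mk_diag_comp_mk_diag`, `Perfection.exists_liftLevel_eq_of_mk_eq`
  — bookkeeping at "diagonal" levels `(c, c)` between roots `(A, 1)`: the image of `φ` is the class of any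
  conjugate of `φ` along `A → A^{(c)}`, `B → B^{(c)}`; composition of diagonal representatives is
  composition in `C`; equal classes agree after transport to a higher diagonal level;
* `Perfection.base_map_app_eq_id` — for `D` slim, the components of an automorphism of `C → C^pf` are
  base-identity automorphisms (Prop. 1.13 (i) for `C → D`, through `C → C^pf → D ≅ C → D`, the on-the-nose
  square `toPfCompBaseIso` of Prop. 3.2 (i));
* `Perfection.app_eq_id_of_isFrobeniusTrivial` — … and trivial at FROBENIUS-TRIVIAL objects when `C` is
  of Frobenius-normalized type: naturality along the base-identity endomorphism `ζ₂` of Frobenius degree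
  `2` reads, at a common level `A^{(m)}`, `ζ₂′ ≫ θ = θ ≫ ζ₂′` for the conjugate `ζ₂′` of `ζ₂` (again
  base-identity of degree `2`) and a base-identity linear representative `θ` of the component;
  Frobenius normalization at `A^{(m)}` gives `ζ₂′ ≫ θ ≫ θ = θ ≫ ζ₂′`, so `θ ≫ θ = θ`, `θ = id` (`C` is
  totally epimorphic) — "the functoriality … with respect to base-identity endomorphisms of
  Frobenius-trivial objects";
* `isRigidFunctor_toPf` — **`C → C^pf` is rigid** for `D` slim and `C` of Frobenius-normalized type
  (Def. 1.3 (i)(a)(b): every object is reached from a Frobenius-trivial one through a span of pre-steps;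
  pre-steps of `C^pf` are monomorphisms (`mono_of_isPreStep`), all arrows of `C^pf` are epimorphisms
  (`epi_hom`)); `isRigidFunctor_comp_toPf` — hence `T ⋙ (C → C^pf)` is rigid for every equivalence `T`,
  the first composite `C₁ ⥲ C₂ → C₂^pf` of the Thm. 3.4 (iii) square; `isRigidFunctor_toPf_comp_of_iso` —
  and so is the second composite `C₁ → C₁^pf → C₂^pf` for ANY `Ψ^pf` making the square `1`-commute.

No statement of the paper is restated or strengthened; HONEST FRAMING: [FrdI] is a refereed, undisputed
paper; nothing here bears on [IUTchIII] Cor. 3.12 beyond supplying kernel-checked inputs by name.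
-/

namespace Literature.AlgebraicGeometry.Frobenioids

open CategoryTheory Opposite

universe w v v' u u' v₁ u₁

namespace PreFrobenioid

variable {D : Type u} [Category.{v} D] {Φ : Dᵒᵖ ⥤ CommMonCat.{w}}
  {C : Type u'} [Category.{v'} C] {F : C ⥤ ElemFrobenioid Φ} {hF : IsFrobenioid F}

namespace Perfection

/-! ### Bookkeeping at diagonal levels between roots `(A, 1)` -/

/-- The image in `C^pf` of `φ : A → B` is the class, at the level `(c, c)`, of ANY arrow `φc` with
`(A → A^{(c)}) ≫ φc = φ ≫ (B → B^{(c)})` (e.g. the Prop. 1.10 (i) conjugate of `φ` along the chosen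
Frobenius-type arrows of degree `c`). [cite: MochizukiFrdI2008, Def. 3.1 (iii) p.57] -/
theorem toPf_map_eq_mk_conj {A B : C} (φ : A ⟶ B) (c : ℕ+) (φc : frobPow hF A c ⟶ frobPow hF B c)
    (hφc : frob hF A c ≫ φc = φ ≫ frob hF B c) :
    (toPf hF).map φ = Hom.mk (X := root hF A 1) (Y := root hF B 1) ⟨⟨c, c, rfl⟩, φc⟩ :=
  map_eq_mk_of_descent (A := A) (B := B) (a := c) (b := c) rfl φc φ hφc.symm

/-- Composition of representatives at a common diagonal level `(c, c)` between roots `(·, 1)` is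
composition in `C` (the composite computed at the triple level `(c, c, c)`).
[cite: MochizukiFrdI2008, Def. 3.1 (iii) p.57] -/
theorem mk_diag_comp_mk_diag {A B E : C} (c : ℕ+) (θ : frobPow hF A c ⟶ frobPow hF B c)
    (θ' : frobPow hF B c ⟶ frobPow hF E c) :
    (Hom.mk (X := root hF A 1) (Y := root hF B 1) ⟨⟨c, c, rfl⟩, θ⟩ ≫
        Hom.mk (X := root hF B 1) (Y := root hF E 1) ⟨⟨c, c, rfl⟩, θ'⟩ : root hF A 1 ⟶ root hF E 1) =
      Hom.mk (X := root hF A 1) (Y := root hF E 1) ⟨⟨c, c, rfl⟩, θ ≫ θ'⟩ := by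
  let T : Level₃ (root hF A 1) (root hF B 1) (root hF E 1) := ⟨c, c, c, rfl, rfl⟩
  rw [mk_comp_mk, ← mk_compAt T ⟨⟨c, c, rfl⟩, θ⟩ ⟨⟨c, c, rfl⟩, θ'⟩ (Level.le_rfl _) (Level.le_rfl _)]
  unfold compAt
  rw [Level.lift_rfl, Level.lift_rfl]

/-- Equal classes at a diagonal level `(c, c)` between roots `(·, 1)` agree after transport to some
higher diagonal level `(m, m)`. [cite: MochizukiFrdI2008, Def. 3.1 (ii) p.56] -/
theorem exists_liftLevel_eq_of_mk_eq {A B : C} (c : ℕ+) {θ₁ θ₂ : frobPow hF A c ⟶ frobPow hF B c}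
    (h : Hom.mk (X := root hF A 1) (Y := root hF B 1) ⟨⟨c, c, rfl⟩, θ₁⟩ =
      Hom.mk (X := root hF A 1) (Y := root hF B 1) ⟨⟨c, c, rfl⟩, θ₂⟩) :
    ∃ (m : ℕ+) (hm : c ∣ m)
      (hd : degFr F (frobTrans hF A hm) = degFr F (frobTrans hF B hm)),
      liftLevel hF θ₁ hm hm hd = liftLevel hF θ₂ hm hm hd := by
  obtain ⟨⟨m, m', e⟩, hM, hM', hlift⟩ := Hom.mk_eq_mk.mp h
  have hmm : m = m' := by
    change 1 * m = 1 * m' at e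
    rwa [one_mul, one_mul] at e
  subst hmm
  exact ⟨m, hM.1, Level.degFr_eq _ _ hM, hlift⟩

/-- For an endomorphism representative `θ : A^{(c)} → A^{(c)}` of an endomorphism of the root `(A, 1)`,
`Base` of the class is the identity iff `Base(θ)` is (conjugation by the isomorphism `Base(A → A^{(c)})`).
[cite: MochizukiFrdI2008, Prop. 3.2 (i) p.58] -/
theorem base_eq_id_of_baseMap_mk_diag_eq_id {A : C} (c : ℕ+) (θ : frobPow hF A c ⟶ frobPow hF A c)
    (h : Hom.baseMap (Hom.mk (X := root hF A 1) (Y := root hF A 1) ⟨⟨c, c, rfl⟩, θ⟩) = 𝟙 _) :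
    Base F θ = 𝟙 _ := by
  rw [baseMap_mk] at h
  change Base F (frob hF A c) ≫ Base F θ ≫ baseInvFrob hF A c = 𝟙 _ at h
  haveI := isIso_base_frob hF A c
  have h' : Base F (frob hF A c) ≫ Base F θ = Base F (frob hF A c) := by
    have := congrArg (· ≫ Base F (frob hF A c)) h
    simpa only [Category.assoc, baseInvFrob_base_frob, Category.comp_id, Category.id_comp] using this
  exact (cancel_epi (Base F (frob hF A c))).mp (h'.trans (Category.comp_id _).symm)

/-- A conjugate of a base-identity endomorphism along a Frobenius-type arrow is base-identity.
[cite: MochizukiFrdI2008, Prop. 1.10 (i) p.34] -/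
theorem base_eq_id_of_conj {A A' : C} {f : A ⟶ A} {α : A ⟶ A'} (hα : IsIso (Base F α)) {f' : A' ⟶ A'}
    (hsq : α ≫ f' = f ≫ α) (hf : Base F f = 𝟙 _) : Base F f' = 𝟙 _ := by
  haveI := hα
  have h := congrArg (Base F) hsq
  rw [base_comp, base_comp, hf, Category.id_comp] at h
  exact (cancel_epi (Base F α)).mp (h.trans (Category.comp_id _).symm)

/-! ### Automorphisms of `C → C^pf`: base-identity components -/

/-- For `D` slim: the components of an automorphism `α` of the functor `C → C^pf` are base-identity
endomorphisms of `C^pf`: through the on-the-nose square `C → C^pf → D ≅ C → D` (Prop. 3.2 (i)), `α`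
induces an automorphism of `C → D`, trivial by Prop. 1.13 (i). [cite: MochizukiFrdI2008, Thm. 3.4 (iii) p.64] -/
theorem base_map_app_eq_id (hF : IsFrobenioid F) (hD : IsSlim D) (α : toPf hF ≅ toPf hF) (A : C) :
    (ops hF).base.map (α.hom.app A) = 𝟙 _ := by
  let β : PreFrobenioid.baseFunctor F ≅ PreFrobenioid.baseFunctor F :=
    (toPfCompBaseIso (hF := hF)).symm ≪≫ Functor.isoWhiskerRight α (ops hF).base ≪≫ toPfCompBaseIso
  have hβ : β = Iso.refl _ := isRigidFunctor_baseFunctor hF hD β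
  have hβA := congrArg (fun i : PreFrobenioid.baseFunctor F ≅ PreFrobenioid.baseFunctor F => i.hom.app A) hβ
  change 𝟙 _ ≫ (ops hF).base.map (α.hom.app A) ≫ 𝟙 _ = 𝟙 _ at hβA
  rw [Category.id_comp, Category.comp_id] at hβA
  exact hβA

/-! ### Triviality at Frobenius-trivial objects -/

/-- At a FROBENIUS-TRIVIAL object `A` of a Frobenioid of Frobenius-normalized type over a slim base, an
automorphism `α` of `C → C^pf` has trivial component: with `ζ₂` the base-identity endomorphism of
Frobenius degree `2` of `A` and `θ : A^{(c)} → A^{(c)}` a representative of `α_A` (base-identity by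
`base_map_app_eq_id`, linear since `α_A` is an isomorphism), naturality `[ζ₂] ≫ α_A = α_A ≫ [ζ₂]` reads, at
some level `A^{(m)}`, `ζ₂′ ≫ θ′ = θ′ ≫ ζ₂′` for the conjugate `ζ₂′` of `ζ₂` (base-identity, degree `2`);
Frobenius normalization of `A^{(m)}` gives `ζ₂′ ≫ θ′ ≫ θ′ = θ′ ≫ ζ₂′`, so `θ′ ≫ θ′ = θ′` and `θ′ = id`
("by considering … base-identity endomorphisms of Frobenius-trivial objects", p. 64).
[cite: MochizukiFrdI2008, Thm. 3.4 (iii) p.64] -/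
theorem app_eq_id_of_isFrobeniusTrivial (hF : IsFrobenioid F) (hD : IsSlim D)
    (hN : (PreFrobenioidData.ofFunctor Φ F).IsOfFrobeniusNormalizedType) (α : toPf hF ≅ toPf hF) {A : C}
    (hA : IsFrobeniusTrivial F A) : α.hom.app A = 𝟙 _ := by
  have hP := hF.isPreFrobenioid
  obtain ⟨ζ, hζ⟩ := hA
  obtain ⟨hdeg, hbid, -⟩ := hζ 2
  -- the endomorphism `f = ζ₂` of `A` as an arrow
  have hfty : ∃ f : A ⟶ A, f = ζ 2 := ⟨_, rfl⟩
  obtain ⟨f, hf⟩ := hfty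
  have hfdeg : degFr F f = 2 := by rw [hf]; exact hdeg
  have hfbase : Base F f = 𝟙 _ := by rw [hf]; exact hbid
  -- a representative `θ` of `α_A` at a diagonal level `(a, a)`
  obtain ⟨⟨⟨a, b, e⟩, θ⟩, hu⟩ := Hom.mk_surjective (α.hom.app A)
  have hab : a = b := by
    change 1 * a = 1 * b at e
    rwa [one_mul, one_mul] at e
  subst hab
  -- `θ` is base-identity and linear
  have hθb : Base F θ = 𝟙 _ := by
    refine base_eq_id_of_baseMap_mk_diag_eq_id a θ ?_
    have h := base_map_app_eq_id hF hD α A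
    rw [← hu] at h
    exact h
  have hθd : degFr F θ = 1 := by
    have h1 : (ops hF).degFr (α.hom.app A) = 1 := by
      have hmul : (ops hF).degFr (α.hom.app A) * (ops hF).degFr (α.inv.app A) = 1 := by
        rw [← (ops hF).degFr_comp, Iso.hom_inv_id_app, (ops hF).degFr_id]
      have h' := congrArg PNat.val hmul
      rw [PNat.mul_coe, PNat.one_coe] at h'
      exact PNat.coe_inj.mp ((Nat.eq_one_of_mul_eq_one_right h').trans PNat.one_coe.symm)
    rw [← hu] at h1
    exact h1
  -- the conjugate `fa` of `f` at level `a`, and naturality at level `(a, a)`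
  have hfa_ex : ∃ fa : frobPow hF A a ⟶ frobPow hF A a, frob hF A a ≫ fa = f ≫ frob hF A a :=
    ⟨conjFr hF f (isFrobeniusType_frob hF A a) (isFrobeniusType_frob hF A a) rfl,
      conjFr_spec hF f (isFrobeniusType_frob hF A a) (isFrobeniusType_frob hF A a) rfl⟩
  obtain ⟨fa, hfa⟩ := hfa_ex
  have hnat := α.hom.naturality f
  rw [← hu, toPf_map_eq_mk_conj f a fa hfa, mk_diag_comp_mk_diag, mk_diag_comp_mk_diag] at hnat
  obtain ⟨m, hm, hd, hlift⟩ := exists_liftLevel_eq_of_mk_eq a hnat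
  -- the conjugate `fm` of `f` at level `m` and the transport `θm` of `θ`
  have hfm_ex : ∃ fm : frobPow hF A m ⟶ frobPow hF A m, frob hF A m ≫ fm = f ≫ frob hF A m :=
    ⟨conjFr hF f (isFrobeniusType_frob hF A m) (isFrobeniusType_frob hF A m) rfl,
      conjFr_spec hF f (isFrobeniusType_frob hF A m) (isFrobeniusType_frob hF A m) rfl⟩
  obtain ⟨fm, hfm⟩ := hfm_ex
  have hθm_ex : ∃ θm : frobPow hF A m ⟶ frobPow hF A m, θm = liftLevel hF θ hm hm hd := ⟨_, rfl⟩
  obtain ⟨θm, hθm⟩ := hθm_ex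
  have hθm_spec : frobTrans hF A hm ≫ θm = θ ≫ frobTrans hF A hm := by
    rw [hθm]; exact liftLevel_spec hF θ hm hm hd
  -- compatibility of the two conjugates of `f` along the transition `A^{(a)} → A^{(m)}`
  have hcompat : frobTrans hF A hm ≫ fm = fa ≫ frobTrans hF A hm := by
    haveI := epi_frob hF A a
    rw [← cancel_epi (frob hF A a), ← Category.assoc, frob_frobTrans, hfm, ← Category.assoc, hfa,
      Category.assoc, frob_frobTrans]
  -- the transports of the two composites
  have h1 : liftLevel hF (fa ≫ θ) hm hm hd = fm ≫ θm :=
    (liftLevel_unique hF hm hm hd (ψ := fm ≫ θm)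
      (by rw [← Category.assoc, hcompat, Category.assoc, hθm_spec, Category.assoc])).symm
  have h2 : liftLevel hF (θ ≫ fa) hm hm hd = θm ≫ fm :=
    (liftLevel_unique hF hm hm hd (ψ := θm ≫ fm)
      (by rw [← Category.assoc, hθm_spec, Category.assoc, hcompat, Category.assoc])).symm
  have key : fm ≫ θm = θm ≫ fm := by rw [← h1, ← h2, hlift]
  -- properties at level `m`
  have hfm_base : Base F fm = 𝟙 _ := base_eq_id_of_conj (isIso_base_frob hF A m) hfm hfbase
  have hfm_deg : degFr F fm = 2 :=
    (degFr_frobeniusConjugate hfm rfl).trans hfdeg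
  have hθm_base : Base F θm = 𝟙 _ :=
    base_eq_id_of_conj (isFrobeniusType_frobTrans hF A hm).2 hθm_spec hθb
  have hθm_deg : degFr F θm = 1 :=
    (degFr_frobeniusConjugate hθm_spec rfl).trans hθd
  have hθm_mem : (θm : End (frobPow hF A m)) ∈ endSubmonoid F (frobPow hF A m) := ⟨hθm_base, hθm_deg⟩
  -- Frobenius normalization at `A^{(m)}`: `fm ≫ θm ^ 2 = θm ≫ fm`
  have hnormA : IsFrobeniusNormalized F (frobPow hF A m) := fun φ hφ β hβ =>
    hN.obj (frobPow hF A m) φ hφ β hβ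
  have hn := hnormA fm hfm_base θm hθm_mem
  have hfm_deg' : (degFr F fm : ℕ) = 2 := by rw [hfm_deg]; rfl
  rw [hfm_deg', pow_two] at hn
  -- `fm ≫ θm ≫ θm = θm ≫ fm = fm ≫ θm`, cancel the epimorphism `fm`, then the epimorphism `θm`
  have hn' : fm ≫ θm ≫ θm = fm ≫ θm := by
    have hn'' : fm ≫ θm ≫ θm = θm ≫ fm := hn
    exact hn''.trans key.symm
  haveI : Epi fm := hP.isTotallyEpimorphic.epi fm
  have hθθ : θm ≫ θm = θm := (cancel_epi fm).mp hn'
  haveI : Epi θm := hP.isTotallyEpimorphic.epi θm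
  have hθm1 : θm = 𝟙 _ := (cancel_epi θm).mp (hθθ.trans (Category.comp_id θm).symm)
  -- conclude: `α_A = [θ] = [θm] = [id] = id`
  rw [← hu, ← Hom.mk_lift ⟨⟨a, a, e⟩, θ⟩ ⟨m, m, rfl⟩ ⟨hm, hm⟩]
  change Hom.mk ⟨⟨m, m, rfl⟩, liftLevel hF θ hm hm _⟩ = _
  rw [show liftLevel hF θ hm hm (Level.degFr_eq ⟨a, a, e⟩ ⟨m, m, rfl⟩ ⟨hm, hm⟩) = θm from hθm.symm, hθm1,
    id_eq_mk, ← Hom.mk_lift (Rep.id (root hF A 1)) ⟨m, m, rfl⟩ ⟨one_dvd m, one_dvd m⟩]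
  change _ = Hom.mk ⟨⟨m, m, rfl⟩, liftLevel hF (𝟙 _) (one_dvd m) (one_dvd m) _⟩
  rw [liftLevel_id]

end Perfection

open Perfection in
/-- **Thm. 3.4 (iii), rigidity: `C → C^pf` is rigid** for a Frobenioid `C` of Frobenius-normalized type
over a slim base `D` (FrdI p. 64: "it suffices … to apply Proposition 1.13, (ii) [here: (i), through the
base], and to consider the functoriality of the automorphisms in question with respect to base-identity
endomorphisms of Frobenius-trivial objects"). Reduction to Frobenius-trivial objects: by Def. 1.3 (i)(a)(b)
every `A` is the target of a pre-step `ψ : X → A` from the source of a pre-step `φ : X → A₀` with `A₀`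
Frobenius-trivial; `[φ]` is a monomorphism and `[ψ]` an epimorphism of `C^pf`, so
`α_{A₀} = id ⇒ α_X = id ⇒ α_A = id`. [cite: MochizukiFrdI2008, Thm. 3.4 (iii) p.62] -/
theorem isRigidFunctor_toPf (hF : IsFrobenioid F) (hD : IsSlim D)
    (hN : (PreFrobenioidData.ofFunctor Φ F).IsOfFrobeniusNormalizedType) :
    IsRigidFunctor (Perfection.toPf hF) := by
  intro α
  ext A
  change α.hom.app A = 𝟙 _
  -- a Frobenius-trivial `A₀` over `A_D` and a span of pre-steps `A₀ ← X → A`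
  obtain ⟨A₀, hA₀, ⟨e⟩⟩ := hF.i_a (baseObj F A)
  obtain ⟨X, φ, ψ, hφ, -, -⟩ := hF.i_b A₀ A e
  have h₀ : α.hom.app A₀ = 𝟙 _ := app_eq_id_of_isFrobeniusTrivial hF hD hN α hA₀
  -- `α_X = id`: naturality at the pre-step `φ`, whose image is a pre-step, hence a monomorphism, of `C^pf`
  have hφ' : (ops hF).IsPreStep ((toPf hF).map φ) :=
    preservesMor_isPreStep hF φ ((PreFrobenioidData.ofFunctor_isPreStep F φ).2 hφ)
  haveI : Mono ((toPf hF).map φ) := mono_of_isPreStep hφ'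
  have hX : α.hom.app X = 𝟙 _ := by
    have hn := α.hom.naturality φ
    rw [h₀, Category.comp_id] at hn
    exact (cancel_mono ((toPf hF).map φ)).mp (hn.symm.trans (Category.id_comp _).symm)
  -- `α_A = id`: naturality at `ψ`, an epimorphism of `C^pf`
  haveI : Epi ((toPf hF).map ψ) := epi_hom _
  have hn := α.hom.naturality ψ
  rw [hX, Category.id_comp] at hn
  exact (cancel_epi ((toPf hF).map ψ)).mp (hn.trans (Category.comp_id _).symm)

/-- The same for the datum `PreFrobenioidData.perfection hF` (whose `toPf` IS `Perfection.toPf hF`).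
[cite: MochizukiFrdI2008, Thm. 3.4 (iii) p.62] -/
theorem isRigidFunctor_perfection_toPf (hF : IsFrobenioid F) (hD : IsSlim D)
    (hN : (PreFrobenioidData.ofFunctor Φ F).IsOfFrobeniusNormalizedType) :
    IsRigidFunctor (PreFrobenioidData.perfection hF).toPf :=
  isRigidFunctor_toPf hF hD hN

section Equivalence

variable {C₁ : Type u₁} [Category.{v₁} C₁]

/-- **Thm. 3.4 (iii), rigidity, first composite**: `T ⋙ (C → C^pf)` is rigid for every equivalence
`T : C₁ ⥲ C`, `D` slim, `C` of Frobenius-normalized type — in particular the composite `C₁ ⥲ C₂ → C₂^pf`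
of the perfection square. [cite: MochizukiFrdI2008, Thm. 3.4 (iii) p.62] -/
theorem isRigidFunctor_comp_toPf (hF : IsFrobenioid F) (hD : IsSlim D)
    (hN : (PreFrobenioidData.ofFunctor Φ F).IsOfFrobeniusNormalizedType) (T : C₁ ⥤ C) [T.IsEquivalence] :
    IsRigidFunctor (T ⋙ (PreFrobenioidData.perfection hF).toPf) :=
  IsRigidFunctor.comp_of_isEquivalence T (isRigidFunctor_toPf hF hD hN)

variable {P₁ : Type u₁} [Category.{v₁} P₁]

/-- **Thm. 3.4 (iii), rigidity, second composite**: for an equivalence `Ψ : C₁ ⥲ C₂`, any functor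
`L : C₁ → P₁` (e.g. `C₁ → C₁^pf`) and ANY `Ψ^pf : P₁ → C₂^pf` with `Ψ ⋙ (C₂ → C₂^pf) ≅ L ⋙ Ψ^pf`
(`1`-commutativity), the composite `L ⋙ Ψ^pf` is rigid (rigidity is invariant under isomorphism of
functors). Together with `isRigidFunctor_comp_toPf` this is "each of the composite functors of this
diagram is rigid" for the perfection square. [cite: MochizukiFrdI2008, Thm. 3.4 (iii) p.62] -/
theorem isRigidFunctor_toPf_comp_of_iso (hF : IsFrobenioid F) (hD : IsSlim D)
    (hN : (PreFrobenioidData.ofFunctor Φ F).IsOfFrobeniusNormalizedType) (Ψ : C₁ ≌ C)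
    (L : C₁ ⥤ P₁) (Ψpf : P₁ ⥤ (PreFrobenioidData.perfection hF).Pf)
    (η : Ψ.functor ⋙ (PreFrobenioidData.perfection hF).toPf ≅ L ⋙ Ψpf) :
    IsRigidFunctor (Ψ.functor ⋙ (PreFrobenioidData.perfection hF).toPf) ∧ IsRigidFunctor (L ⋙ Ψpf) := by
  have h := isRigidFunctor_comp_toPf hF hD hN Ψ.functor
  refine ⟨h, fun β => ?_⟩
  have hβ := h (η ≪≫ β ≪≫ η.symm)
  have h' : β = η.symm ≪≫ (η ≪≫ β ≪≫ η.symm) ≪≫ η := by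
    ext X
    simp
  rw [h', hβ]
  ext X
  simp

end Equivalence

end PreFrobenioid

end Literature.AlgebraicGeometry.Frobenioids
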